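import Literature.Analysis.FluidPDE.NSBoundedSuitableEnergy
import Literature.Analysis.FluidPDE.SlicedLocalEnergy
import Literature.Analysis.FluidPDE.LaplaceDivFormRoundOne
import Literature.Analysis.FluidPDE.DistributionalPressurePoisson
import Literature.Analysis.Calculus.SmoothCutoff
import HarnessLib

/-!
# The energy class of bounded distributional Navier–Stokes solutions, quantitatively, up to the top

Analysis/FluidPDE proofs file (theorems only; no definitions, no named facts). The accepted
`NSBoundedEnergyClass_holds` / `exists_hasWeakSpatialGradientOn_of_bounded`
(`NSBoundedEnergyClassProofs.lean`; Seregin–Šverák 2009, §2 p. 6; Seregin 2014, §6.3) give a weak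
spatial gradient `G = ∇u ∈ L²_loc` of an essentially bounded distributional solution with
`p ∈ L^{3/2}` — qualitatively. The higher-regularity bootstrap with constants
(`NSBoundedHigherRegularityBounds`) starts from a **quantitative** bound, up to the top of the
backward cylinder: `exists_weakGradient_energy_bound` — for `0 < r < R` there is `C = C(r, R)`
with `∫∫_{Q_r(z)} |∇u|² ≤ C (1 + M)³ (1 + P)` whenever `|u| ≤ M` a.e. on `Q_R(z)` and
`∫∫_{Q_R(z)} |p|^{3/2} ≤ P`.

Proof: bounded distributional solutions with `p ∈ L^{3/2}` are suitable weak solutions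
(`isSuitableWeakSolutionOn_of_bounded`, Seregin–Šverák 2009, §2, Remark 3.4); the sliced local
energy inequality (`IsSuitableWeakSolutionOn.ae_localEnergy_slice`, CKN 1982, (2.5)) is tested
with `φ_ε(s, y) = χ(s) η_ε(s) θ(x - y)`, `χ` a bottom ramp, `θ` a translated radial cut-off
(`LaplaceDivFormRoundOne`), and `η_ε` a *decreasing* top ramp, whose contribution to `∂ₜφ_ε` is
non-positive — so the right-hand side is bounded independently of `ε` by
`M²(sup χ' + sup |Δθ|)|Q| + (M³ + 2M|p|) sup |∇θ|` integrated — and the bounds below a.e. time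
`s < t` exhaust `Q_r(z)` (Robinson–Rodrigo–Sadowski 2016, p. 242).

## References

* G. Seregin, V. Šverák, Comm. PDE 34 (2009) = arXiv:0804.1803, §2 p. 6, Remark 3.4.
  [`SereginSverak2009`]
* L. Caffarelli, R. Kohn, L. Nirenberg, Comm. Pure Appl. Math. 35 (1982), §2 (2.5).
  [`CaffarelliKohnNirenberg1982`]
* J. C. Robinson, J. L. Rodrigo, W. Sadowski, *The Three-Dimensional Navier–Stokes Equations*
  (2016), proof of Thm. 16.1, p. 242. [`RobinsonRodrigoSadowskiCUP2016`]
-/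

noncomputable section

open MeasureTheory Set Function Filter Topology TopologicalSpace Metric
open scoped NNReal ENNReal RealInnerProductSpace Laplacian

namespace Literature.Analysis.FluidPDE

namespace NSEnergyQuant

/-! ### Exhaustion below a.e. time -/

/-- From an a.e. statement below a time `t₀` one can pick good times arbitrarily close to `t₀`.
[folklore] -/
theorem exists_seq_tendsto_of_ae_lt {t₀ : ℝ} {P : ℝ → Prop}
    (h : ∀ᵐ s ∂(volume : Measure ℝ), s < t₀ → P s) :
    ∃ s : ℕ → ℝ, (∀ j, s j < t₀) ∧ (∀ j : ℕ, t₀ - 1 / ((j : ℝ) + 1) < s j) ∧ ∀ j, P (s j) := by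
  have hj : ∀ j : ℕ, ∃ s, s < t₀ ∧ t₀ - 1 / ((j : ℝ) + 1) < s ∧ P s := by
    intro j
    by_contra hne
    have hsub : Ioo (t₀ - 1 / ((j : ℝ) + 1)) t₀ ⊆ {s | ¬(s < t₀ → P s)} := by
      intro s hs hs'
      exact hne ⟨s, hs.2, hs.1, hs' hs.2⟩
    have h0 : (volume : Measure ℝ) {s | ¬(s < t₀ → P s)} = 0 := ae_iff.1 h
    have hpos : 0 < (volume : Measure ℝ) (Ioo (t₀ - 1 / ((j : ℝ) + 1)) t₀) := by
      rw [Real.volume_Ioo]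
      have : (0 : ℝ) < 1 / ((j : ℝ) + 1) := Nat.one_div_pos_of_nat
      exact ENNReal.ofReal_pos.2 (by linarith)
    exact (lt_of_lt_of_le hpos ((measure_mono hsub).trans h0.le)).ne rfl
  choose s hs0 hsj hP using hj
  exact ⟨s, hs0, hsj, hP⟩

/-- **From bounds below a.e. time `s < t₀` to the bound up to `t₀`.** Let `T` be a set of
space–time points with times `< t₀` and `F ≥ 0`. If for a.e. `s < t₀` the integral of `F`
over `T ∩ {t < s}` is at most `Y`, then so is the integral over `T`. [folklore] -/
theorem setLIntegral_le_of_ae_lt_time {X : Type*} [MeasurableSpace X] {μ : Measure (ℝ × X)}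
    {t₀ : ℝ} {T : Set (ℝ × X)} (hT : ∀ z ∈ T, z.1 < t₀) {F : ℝ × X → ℝ≥0∞} {Y : ℝ≥0∞}
    (h : ∀ᵐ s ∂(volume : Measure ℝ), s < t₀ → ∫⁻ z in T ∩ {z | z.1 < s}, F z ∂μ ≤ Y) :
    ∫⁻ z in T, F z ∂μ ≤ Y := by
  obtain ⟨s, hs0, hsj, hP⟩ := exists_seq_tendsto_of_ae_lt h
  have hcof : ∀ t : ℝ, t < t₀ → ∃ j, t < s j := by
    intro t ht
    obtain ⟨j, hj⟩ := exists_nat_one_div_lt (by linarith : 0 < t₀ - t)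
    exact ⟨j, by linarith [hsj j]⟩
  have hdir : Directed (· ⊆ ·) fun j => T ∩ {z : ℝ × X | z.1 < s j} := by
    intro j₁ j₂
    obtain ⟨j, hj⟩ := hcof (max (s j₁) (s j₂)) (max_lt (hs0 j₁) (hs0 j₂))
    refine ⟨j, fun z hz => ⟨hz.1, ?_⟩, fun z hz => ⟨hz.1, ?_⟩⟩
    · exact lt_trans (lt_of_lt_of_le hz.2 (le_max_left _ _)) hj
    · exact lt_trans (lt_of_lt_of_le hz.2 (le_max_right _ _)) hj
  have hU : (⋃ j, T ∩ {z : ℝ × X | z.1 < s j}) = T := by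
    refine subset_antisymm (iUnion_subset fun j => inter_subset_left) fun z hz => ?_
    obtain ⟨j, hj⟩ := hcof z.1 (hT z hz)
    exact mem_iUnion.2 ⟨j, hz, hj⟩
  rw [← hU, setLIntegral_iUnion_of_directed _ hdir]
  exact iSup_le fun j => hP j

/-! ### The ramps in time -/

/-- **The bottom ramp**: smooth, monotone, `0` before `a`, `1` after `b > a`, with
`0 ≤ χ' ≤ D/(b - a)`. [folklore] -/
theorem exists_bottom_ramp : ∃ D : ℝ, 0 ≤ D ∧ ∀ a b : ℝ, a < b →
    ∃ χ : ℝ → ℝ, ContDiff ℝ (⊤ : ℕ∞) χ ∧ (∀ s, 0 ≤ χ s ∧ χ s ≤ 1) ∧ (∀ s, s ≤ a → χ s = 0) ∧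
      (∀ s, b ≤ s → χ s = 1) ∧ (∀ s, 0 ≤ deriv χ s) ∧ ∀ s, deriv χ s ≤ D / (b - a) := by
  obtain ⟨D, hD0, hD⟩ := Calculus.exists_bound_deriv_smoothTransition
  refine ⟨D, hD0, fun a b hab => ?_⟩
  have hba : 0 < b - a := sub_pos.2 hab
  set ℓ : ℝ → ℝ := fun s => (s - a) / (b - a) with hℓ
  have hℓd : ∀ s, HasDerivAt ℓ (1 / (b - a)) s := fun s => by
    have := ((hasDerivAt_id s).sub_const a).div_const (b - a)
    simpa [hℓ] using this
  have hχd : ∀ s, HasDerivAt (fun s => Real.smoothTransition (ℓ s))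
      (deriv Real.smoothTransition (ℓ s) * (1 / (b - a))) s := fun s =>
    (Calculus.differentiable_smoothTransition _).hasDerivAt.comp s (hℓd s)
  refine ⟨fun s => Real.smoothTransition (ℓ s), ?_, ?_, ?_, ?_, ?_, ?_⟩
  · exact Real.smoothTransition.contDiff.comp ((contDiff_id.sub contDiff_const).div_const _)
  · exact fun s => ⟨Real.smoothTransition.nonneg _, Real.smoothTransition.le_one _⟩
  · intro s hs
    exact Real.smoothTransition.zero_of_nonpos (div_nonpos_of_nonpos_of_nonneg (by linarith) hba.le)
  · intro s hs
    refine Real.smoothTransition.one_of_one_le ?_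
    rw [hℓ, le_div_iff₀ hba]; linarith
  · intro s
    rw [(hχd s).deriv]
    exact mul_nonneg (Real.smoothTransition.monotone.deriv_nonneg) (by positivity)
  · intro s
    rw [(hχd s).deriv]
    calc deriv Real.smoothTransition (ℓ s) * (1 / (b - a)) ≤ D * (1 / (b - a)) :=
          mul_le_mul_of_nonneg_right ((le_abs_self _).trans (hD _)) (by positivity)
      _ = D / (b - a) := by ring

/-- **The top ramp**: smooth, `1` before `t₀ - 2ε`, `0` after `t₀ - ε`, values in `[0, 1]`,
and **non-increasing**: `η' ≤ 0`. [folklore] -/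
theorem exists_top_ramp {t₀ ε : ℝ} (hε : 0 < ε) :
    ∃ η : ℝ → ℝ, ContDiff ℝ (⊤ : ℕ∞) η ∧ (∀ s, 0 ≤ η s ∧ η s ≤ 1) ∧ (∀ s, s ≤ t₀ - 2 * ε → η s = 1) ∧
      (∀ s, t₀ - ε ≤ s → η s = 0) ∧ ∀ s, deriv η s ≤ 0 := by
  set ℓ : ℝ → ℝ := fun s => (t₀ - ε - s) / ε with hℓ
  have hℓd : ∀ s, HasDerivAt ℓ (-(1 / ε)) s := fun s => by
    have := ((hasDerivAt_id s).const_sub (t₀ - ε)).div_const ε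
    simpa [hℓ, neg_div] using this
  have hηd : ∀ s, HasDerivAt (fun s => Real.smoothTransition (ℓ s))
      (deriv Real.smoothTransition (ℓ s) * (-(1 / ε))) s := fun s =>
    (Calculus.differentiable_smoothTransition _).hasDerivAt.comp s (hℓd s)
  refine ⟨fun s => Real.smoothTransition (ℓ s), ?_, ?_, ?_, ?_, ?_⟩
  · exact Real.smoothTransition.contDiff.comp ((contDiff_const.sub contDiff_id).div_const _)
  · exact fun s => ⟨Real.smoothTransition.nonneg _, Real.smoothTransition.le_one _⟩
  · intro s hs
    refine Real.smoothTransition.one_of_one_le ?_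
    rw [hℓ, le_div_iff₀ hε]; linarith
  · intro s hs
    exact Real.smoothTransition.zero_of_nonpos (div_nonpos_of_nonpos_of_nonneg (by linarith) hε.le)
  · intro s
    rw [(hηd s).deriv]
    have h1 : 0 ≤ deriv Real.smoothTransition (ℓ s) := Real.smoothTransition.monotone.deriv_nonneg
    have h2 : -(1 / ε) ≤ 0 := by rw [neg_nonpos]; positivity
    exact mul_nonpos_of_nonneg_of_nonpos h1 h2

/-! ### The quantitative energy bound up to the top -/

/-- The backward parabolic cylinder has the measure `R² |B(0, R)|` (independent of the centre). [folklore] -/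
theorem volume_parabolicCylinder_eq (R : ℝ) (z : ℝ × EuclideanSpace ℝ (Fin 3)) :
    volume (parabolicCylinder R z) =
      ENNReal.ofReal (R ^ 2) * volume (ball (0 : EuclideanSpace ℝ (Fin 3)) R) := by
  rw [parabolicCylinder, Measure.volume_eq_prod, Measure.prod_prod, Real.volume_Ioo,
    Measure.addHaar_ball_center]
  congr 1
  congr 1
  ring

set_option maxHeartbeats 6400000 in
/-- **Quantitative energy class of bounded distributional solutions, up to the top.** For
`0 < r < R` there is `C = C(r, R)` such that: if `(u, p)` solves the Navier–Stokes system
(`ν = 1`, no force) in the sense of distributions in `Q_R(z)` with `|u| ≤ M` a.e. and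
`∫∫_{Q_R(z)} |p|^{3/2} ≤ P`, then `u` has a weak spatial gradient `G` on `Q_R(z)` with
`∫∫_K |G|² < ∞` on compacts and `∫∫_{Q_r(z)} |G|² ≤ C (1 + |M|)³ (1 + P)` (Seregin–Šverák 2009,
§2: bounded distributional solutions are suitable; CKN 1982, (2.5) tested with a cut-off reaching
the top). [cite: SereginSverak2009, §2 p. 6 and Remark 3.4] -/
theorem exists_weakGradient_energy_bound {r R : ℝ} (hr : 0 < r) (hrR : r < R) :
    ∃ C : ℝ≥0, ∀ (u : ℝ → EuclideanSpace ℝ (Fin 3) → EuclideanSpace ℝ (Fin 3))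
      (p : ℝ → EuclideanSpace ℝ (Fin 3) → ℝ) (z : ℝ × EuclideanSpace ℝ (Fin 3)) (M : ℝ) (P : ℝ≥0),
      IsDistributionalNSSolutionOn (parabolicCylinderOpens R z) 1 0 u p →
      (∀ᵐ w ∂(volume.restrict (parabolicCylinder R z)), ‖u w.1 w.2‖ ≤ M) →
      (∫⁻ w in parabolicCylinder R z, ‖p w.1 w.2‖ₑ ^ (3 / 2 : ℝ) ≤ P) →
      ∃ G : ℝ → EuclideanSpace ℝ (Fin 3) → EuclideanSpace ℝ (Fin 3) →L[ℝ] EuclideanSpace ℝ (Fin 3),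
        HasWeakSpatialGradientOn (parabolicCylinderOpens R z) u G ∧
        (∀ K ⊆ parabolicCylinder R z, IsCompact K →
          ∫⁻ w in K, ENNReal.ofReal (frobeniusNormSq (G w.1 w.2)) < ∞) ∧
        ∫⁻ w in parabolicCylinder r z, ENNReal.ofReal (frobeniusNormSq (G w.1 w.2)) ≤
          C * ENNReal.ofReal ((1 + |M|) ^ 3 * (1 + (P : ℝ))) := by
  -- geometry and the constants of the cut-offs
  have hR0 : 0 < R := hr.trans hrR
  set r' : ℝ := (r + R) / 2 with hr'
  have hrr' : r < r' := by rw [hr']; linarith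
  have hr'R : r' < R := by rw [hr']; linarith
  have hr'0 : 0 < r' := hr.trans hrr'
  have hgap : 0 < r' ^ 2 - r ^ 2 := by nlinarith
  obtain ⟨D, hD0, hramp⟩ := exists_bottom_ramp
  obtain ⟨Kθ, hKθ0, hKθ⟩ := LaplaceDivFormRoundOne.exists_bound_fderiv_radialCutoff hr.le hrr'
  obtain ⟨KΔ, hKΔ0, hKΔ⟩ := LaplaceDivFormRoundOne.exists_bound_laplacian_radialCutoff hr.le hrr'
  set Dχ : ℝ := D / (r' ^ 2 - r ^ 2) with hDχ
  have hDχ0 : 0 ≤ Dχ := div_nonneg hD0 hgap.le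
  set VQ : ℝ := (ENNReal.ofReal (R ^ 2) * volume (ball (0 : EuclideanSpace ℝ (Fin 3)) R)).toReal with hVQ
  have hVQ0 : 0 ≤ VQ := ENNReal.toReal_nonneg
  set C₀ : ℝ := (Dχ + KΔ + Kθ) * VQ + 2 * Kθ * (VQ + 1) with hC₀
  have hC₀0 : 0 ≤ C₀ := by positivity
  refine ⟨(C₀ / 2).toNNReal, ?_⟩
  intro u p z M P hsol hbd hP
  -- the suitable weak solution and its weak gradient
  set Q : Set (ℝ × EuclideanSpace ℝ (Fin 3)) := parabolicCylinder R z with hQ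
  have hQdef : Q = Ioo (z.1 - R ^ 2) z.1 ×ˢ ball z.2 R := rfl
  have hQopen : IsOpen Q := isOpen_Ioo.prod isOpen_ball
  have hQmeas : MeasurableSet Q := hQopen.measurableSet
  have hQvol : volume Q = ENNReal.ofReal (R ^ 2) * volume (ball (0 : EuclideanSpace ℝ (Fin 3)) R) :=
    volume_parabolicCylinder_eq R z
  have hQfin : volume Q < ⊤ := by
    rw [hQvol]; exact ENNReal.mul_lt_top ENNReal.ofReal_lt_top measure_ball_lt_top
  have hQvolR : (volume Q).toReal = VQ := by rw [hQvol]
  haveI : IsFiniteMeasure ((volume : Measure (ℝ × EuclideanSpace ℝ (Fin 3))).restrict Q) :=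
    isFiniteMeasure_restrict.2 hQfin.ne
  have hp32 : ∫⁻ w in Q, ‖p w.1 w.2‖ₑ ^ (3 / 2 : ℝ) < ∞ := hP.trans_lt ENNReal.coe_lt_top
  have hsw : IsSuitableWeakSolutionOn (parabolicCylinderOpens R z) 1 0 u p :=
    isSuitableWeakSolutionOn_of_bounded one_pos hsol hQfin hbd hp32
  obtain ⟨G, hG, hGloc, -⟩ := hsw.localEnergy
  refine ⟨G, hG, hGloc, ?_⟩
  -- basic integrability of the data
  have hM : 0 ≤ |M| := abs_nonneg M
  have hbd' : ∀ᵐ w ∂(volume : Measure (ℝ × EuclideanSpace ℝ (Fin 3))), w ∈ Q → ‖u w.1 w.2‖ ≤ |M| :=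
    ((ae_restrict_iff' hQmeas).1 hbd).mono fun w hw hwQ => (hw hwQ).trans (le_abs_self M)
  have hum : AEStronglyMeasurable (uncurry u) (volume.restrict Q) := hsol.1.aestronglyMeasurable
  have hpm : AEStronglyMeasurable (uncurry p) (volume.restrict Q) := hsol.2.2.1.aestronglyMeasurable
  have hu3 : LocallyIntegrableOn (fun w : ℝ × EuclideanSpace ℝ (Fin 3) => ‖u w.1 w.2‖ ^ 3) Q volume := by
    refine IntegrableOn.locallyIntegrableOn ?_
    refine Integrable.mono' (integrable_const (|M| ^ 3)) (hum.norm.pow 3) ?_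
    rw [ae_restrict_iff' hQmeas]
    filter_upwards [hbd'] with w hw hwQ
    rw [Real.norm_eq_abs, abs_pow, abs_norm]
    exact pow_le_pow_left₀ (norm_nonneg _) (hw hwQ) 3
  have hfu : LocallyIntegrableOn (fun w : ℝ × EuclideanSpace ℝ (Fin 3) =>
      ⟪(0 : ℝ → EuclideanSpace ℝ (Fin 3) → EuclideanSpace ℝ (Fin 3)) w.1 w.2, u w.1 w.2⟫) Q volume := by
    have : (fun w : ℝ × EuclideanSpace ℝ (Fin 3) =>
        ⟪(0 : ℝ → EuclideanSpace ℝ (Fin 3) → EuclideanSpace ℝ (Fin 3)) w.1 w.2, u w.1 w.2⟫) = fun _ => 0 := by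
      funext w; simp
    rw [this]
    exact integrableOn_zero.locallyIntegrableOn
  -- `|p|` and `|p|^{3/2}` on `Q`
  have hp32i : IntegrableOn (fun w : ℝ × EuclideanSpace ℝ (Fin 3) => |p w.1 w.2| ^ (3 / 2 : ℝ)) Q volume := by
    have hm : AEStronglyMeasurable (fun w : ℝ × EuclideanSpace ℝ (Fin 3) => |p w.1 w.2| ^ (3 / 2 : ℝ))
        (volume.restrict Q) := by
      have e : (fun w : ℝ × EuclideanSpace ℝ (Fin 3) => |p w.1 w.2| ^ (3 / 2 : ℝ)) =
          fun w => ‖uncurry p w‖ ^ (3 / 2 : ℝ) := by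
        funext w; rw [Real.norm_eq_abs]; rfl
      rw [e]
      exact (hpm.aemeasurable.norm.pow_const _).aestronglyMeasurable
    refine ⟨hm, ?_⟩
    rw [hasFiniteIntegral_iff_enorm]
    refine lt_of_le_of_lt (lintegral_mono fun w => le_of_eq ?_) hp32
    rw [Real.enorm_eq_ofReal (Real.rpow_nonneg (abs_nonneg _) _), Real.enorm_eq_ofReal_abs,
      ENNReal.ofReal_rpow_of_nonneg (abs_nonneg _) (by norm_num)]
  have hp32val : ∫ w in Q, |p w.1 w.2| ^ (3 / 2 : ℝ) ≤ (P : ℝ) := by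
    have h1 : ENNReal.ofReal (∫ w in Q, |p w.1 w.2| ^ (3 / 2 : ℝ)) =
        ∫⁻ w in Q, ENNReal.ofReal (|p w.1 w.2| ^ (3 / 2 : ℝ)) :=
      ofReal_integral_eq_lintegral_ofReal hp32i
        (Eventually.of_forall fun w => Real.rpow_nonneg (abs_nonneg _) _)
    have h2 : ∫⁻ w in Q, ENNReal.ofReal (|p w.1 w.2| ^ (3 / 2 : ℝ)) ≤ P := by
      refine (lintegral_mono fun w => le_of_eq ?_).trans hP
      rw [Real.enorm_eq_ofReal_abs, ENNReal.ofReal_rpow_of_nonneg (abs_nonneg _) (by norm_num)]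
    have h3 : ENNReal.ofReal (∫ w in Q, |p w.1 w.2| ^ (3 / 2 : ℝ)) ≤ P := h1.trans_le h2
    have h4 := ENNReal.toReal_mono ENNReal.coe_ne_top h3
    rwa [ENNReal.toReal_ofReal (integral_nonneg fun w => Real.rpow_nonneg (abs_nonneg _) _),
      ENNReal.coe_toReal] at h4
  have hpabs : IntegrableOn (fun w : ℝ × EuclideanSpace ℝ (Fin 3) => |p w.1 w.2|) Q volume := by
    refine Integrable.mono' ((integrable_const (1 : ℝ)).add hp32i) hpm.norm ?_
    refine Eventually.of_forall fun w => ?_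
    rw [Real.norm_eq_abs, abs_abs]
    show |p w.1 w.2| ≤ 1 + |p w.1 w.2| ^ (3 / 2 : ℝ)
    rcases le_or_gt (|p w.1 w.2|) 1 with h | h
    · linarith [Real.rpow_nonneg (abs_nonneg (p w.1 w.2)) (3 / 2 : ℝ)]
    · have : |p w.1 w.2| ≤ |p w.1 w.2| ^ (3 / 2 : ℝ) := by
        calc |p w.1 w.2| = |p w.1 w.2| ^ (1 : ℝ) := (Real.rpow_one _).symm
          _ ≤ |p w.1 w.2| ^ (3 / 2 : ℝ) := Real.rpow_le_rpow_of_exponent_le h.le (by norm_num)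
      linarith
  have hpabs_val : ∫ w in Q, |p w.1 w.2| ≤ VQ + P := by
    calc ∫ w in Q, |p w.1 w.2| ≤ ∫ w in Q, (1 + |p w.1 w.2| ^ (3 / 2 : ℝ)) := by
          refine integral_mono_ae hpabs ((integrable_const (1 : ℝ)).add hp32i) ?_
          refine Eventually.of_forall fun w => ?_
          show |p w.1 w.2| ≤ 1 + |p w.1 w.2| ^ (3 / 2 : ℝ)
          rcases le_or_gt (|p w.1 w.2|) 1 with h | h
          · linarith [Real.rpow_nonneg (abs_nonneg (p w.1 w.2)) (3 / 2 : ℝ)]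
          · have : |p w.1 w.2| ≤ |p w.1 w.2| ^ (3 / 2 : ℝ) := by
              calc |p w.1 w.2| = |p w.1 w.2| ^ (1 : ℝ) := (Real.rpow_one _).symm
                _ ≤ |p w.1 w.2| ^ (3 / 2 : ℝ) := Real.rpow_le_rpow_of_exponent_le h.le (by norm_num)
            linarith
      _ = VQ + ∫ w in Q, |p w.1 w.2| ^ (3 / 2 : ℝ) := by
          rw [integral_add (integrable_const _) hp32i, setIntegral_const, smul_eq_mul, mul_one,
            measureReal_def, hQvolR]
      _ ≤ VQ + P := add_le_add le_rfl hp32val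
  -- the bound to be proved below each good time
  set B : ℝ := C₀ * ((1 + |M|) ^ 3 * (1 + (P : ℝ))) with hB
  have hB0 : 0 ≤ B := by positivity
  have hfinal : ENNReal.ofReal (B / 2) = ((C₀ / 2).toNNReal : ℝ≥0∞) * ENNReal.ofReal ((1 + |M|) ^ 3 * (1 + (P : ℝ))) := by
    rw [hB, show C₀ * ((1 + |M|) ^ 3 * (1 + (P : ℝ))) / 2 = C₀ / 2 * ((1 + |M|) ^ 3 * (1 + (P : ℝ))) by ring,
      ENNReal.ofReal_mul (by positivity)]
    rfl
  rw [← hfinal]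
  -- the elementary majorisation `B₁ ≤ B`
  have hB₁B : |M| ^ 2 * (Dχ + KΔ) * VQ + |M| ^ 3 * Kθ * VQ + 2 * |M| * Kθ * (VQ + P) ≤ B := by
    have h1 : |M| ^ 2 ≤ (1 + |M|) ^ 3 := by nlinarith
    have h2 : |M| ^ 3 ≤ (1 + |M|) ^ 3 := by gcongr; linarith
    have h3 : |M| ≤ (1 + |M|) ^ 3 := by nlinarith
    have hP0 : (0 : ℝ) ≤ P := P.coe_nonneg
    have h4 : VQ + P ≤ (VQ + 1) * (1 + P) := by nlinarith
    calc |M| ^ 2 * (Dχ + KΔ) * VQ + |M| ^ 3 * Kθ * VQ + 2 * |M| * Kθ * (VQ + P)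
        ≤ (1 + |M|) ^ 3 * (Dχ + KΔ) * VQ + (1 + |M|) ^ 3 * Kθ * VQ +
            2 * (1 + |M|) ^ 3 * Kθ * ((VQ + 1) * (1 + P)) := by
          gcongr
      _ ≤ C₀ * ((1 + |M|) ^ 3 * (1 + (P : ℝ))) := by
          rw [hC₀]
          have : (1 + |M|) ^ 3 * (Dχ + KΔ) * VQ + (1 + |M|) ^ 3 * Kθ * VQ ≤
              ((1 + |M|) ^ 3 * (Dχ + KΔ) * VQ + (1 + |M|) ^ 3 * Kθ * VQ) * (1 + P) := by
            have h0 : 0 ≤ (1 + |M|) ^ 3 * (Dχ + KΔ) * VQ + (1 + |M|) ^ 3 * Kθ * VQ := by positivity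
            nlinarith
          nlinarith
  -- the time ramp at the bottom
  obtain ⟨χ, hχs, hχ01, hχ0, hχ1, hχ'0, hχ'le⟩ := hramp (z.1 - r' ^ 2) (z.1 - r ^ 2) (by linarith)
  have hχ'le' : ∀ s, deriv χ s ≤ Dχ := fun s => by
    have := hχ'le s
    rwa [show z.1 - r ^ 2 - (z.1 - r' ^ 2) = r' ^ 2 - r ^ 2 by ring] at this
  have hχd : ∀ s, HasDerivAt χ (deriv χ s) s := fun s =>
    ((hχs.differentiable (by simp)) s).hasDerivAt
  -- the spatial cut-off
  set θ : EuclideanSpace ℝ (Fin 3) → ℝ := fun y => radialCutoff r r' (z.2 - y) with hθ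
  have hθs : ContDiff ℝ (⊤ : ℕ∞) θ := LaplaceDivFormRoundOne.contDiff_cutoff r r' z.2
  have hθ01 : ∀ y, 0 ≤ θ y ∧ θ y ≤ 1 := fun y => ⟨radialCutoff_nonneg _ _ _, radialCutoff_le_one _ _ _⟩
  have hθ0 : ∀ y, r' ≤ dist y z.2 → θ y = 0 := fun y hy =>
    LaplaceDivFormRoundOne.cutoff_eq_zero hr.le hrr' hy
  have hθ1 : ∀ y ∈ ball z.2 r, θ y = 1 := fun y hy =>
    LaplaceDivFormRoundOne.cutoff_eq_one hr.le hrr' (ball_subset_closedBall hy)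
  have hθD : ∀ y, ‖fderiv ℝ θ y‖ ≤ Kθ := fun y => LaplaceDivFormRoundOne.norm_fderiv_cutoff_le hKθ z.2 y
  have hθL : ∀ y, |(Δ θ) y| ≤ KΔ := fun y => by
    rw [hθ, LaplaceDivFormRoundOne.laplacian_cutoff]; exact hKΔ _
  -- for each `ε > 0`: the bound below every good time
  have key : ∀ {ε : ℝ}, 0 < ε → ∀ᵐ s ∂(volume : Measure ℝ),
      ∫⁻ w in parabolicCylinder r z ∩ {w | w.1 < min s (z.1 - 2 * ε)},
        ENNReal.ofReal (frobeniusNormSq (G w.1 w.2)) ≤ ENNReal.ofReal (B / 2) := by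
    intro ε hε
    obtain ⟨η, hηs, hη01, hη1, hη0, hη'⟩ := exists_top_ramp (t₀ := z.1) (ε := ε) hε
    have hηd : ∀ s, HasDerivAt η (deriv η s) s := fun s =>
      ((hηs.differentiable (by simp)) s).hasDerivAt
    -- the test function `φ = χ η θ`
    set φ : ℝ → EuclideanSpace ℝ (Fin 3) → ℝ := fun s y => χ s * η s * θ y with hφ
    have hφ0 : ∀ s y, 0 ≤ φ s y := fun s y =>
      mul_nonneg (mul_nonneg (hχ01 s).1 (hη01 s).1) (hθ01 y).1
    have hφle1 : ∀ s y, φ s y ≤ 1 := fun s y => by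
      have := mul_le_one₀ (mul_le_one₀ (hχ01 s).2 (hη01 s).1 (hη01 s).2) (hθ01 y).1 (hθ01 y).2
      exact this
    set K : Set (ℝ × EuclideanSpace ℝ (Fin 3)) := Icc (z.1 - r' ^ 2) (z.1 - ε) ×ˢ closedBall z.2 r' with hK
    have hKc : IsCompact K := isCompact_Icc.prod (isCompact_closedBall _ _)
    have hKQ : K ⊆ Q := by
      rw [hQdef]
      refine prod_mono (fun s hs => ⟨?_, ?_⟩) (closedBall_subset_ball hr'R)
      · have : r' ^ 2 < R ^ 2 := by nlinarith
        linarith [hs.1]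
      · linarith [hs.2]
    have hsuppK : ∀ w : ℝ × EuclideanSpace ℝ (Fin 3), uncurry φ w ≠ 0 → w ∈ K := by
      rintro ⟨s, y⟩ hw
      simp only [uncurry, hφ] at hw
      have h1 : χ s ≠ 0 := left_ne_zero_of_mul (left_ne_zero_of_mul hw)
      have h2 : η s ≠ 0 := right_ne_zero_of_mul (left_ne_zero_of_mul hw)
      have h3 : θ y ≠ 0 := right_ne_zero_of_mul hw
      refine ⟨⟨?_, ?_⟩, ?_⟩
      · by_contra h; exact h1 (hχ0 s (not_le.1 h).le)
      · by_contra h; exact h2 (hη0 s (not_le.1 h).le)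
      · rw [mem_closedBall]
        by_contra h; exact h3 (hθ0 y (not_le.1 h).le)
    have hφtest : IsSpaceTimeTestOn (parabolicCylinderOpens R z) φ := by
      refine ⟨?_, HasCompactSupport.intro hKc fun w hw => by_contra fun h' => hw (hsuppK w h'), ?_⟩
      · have e : uncurry φ = fun w : ℝ × EuclideanSpace ℝ (Fin 3) => χ w.1 * η w.1 * θ w.2 := by
          funext w; rfl
        rw [e]
        exact ((hχs.comp contDiff_fst).mul (hηs.comp contDiff_fst)).mul (hθs.comp contDiff_snd)
      · exact (closure_minimal (fun w hw => hsuppK w (Function.mem_support.1 hw)) hKc.isClosed).trans hKQ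
    -- the sliced local energy inequality for `φ`
    have hLEI := hsw.ae_localEnergy_slice hG hu3 hfu hφtest hφ0
    filter_upwards [hLEI] with s hs
    -- derived quantities of `φ`
    have hφt : ∀ τ y, timeDeriv φ τ y = (deriv χ τ * η τ + χ τ * deriv η τ) * θ y := by
      intro τ y
      rw [timeDeriv]
      exact (((hχd τ).mul (hηd τ)).mul_const (θ y)).deriv
    have hφt_le : ∀ τ y, timeDeriv φ τ y ≤ Dχ := by
      intro τ y
      rw [hφt]
      have h1 : χ τ * deriv η τ * θ y ≤ 0 :=
        mul_nonpos_of_nonpos_of_nonneg (mul_nonpos_of_nonneg_of_nonpos (hχ01 τ).1 (hη' τ)) (hθ01 y).1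
      have h2 : deriv χ τ * η τ * θ y ≤ Dχ := by
        calc deriv χ τ * η τ * θ y ≤ Dχ * 1 * 1 := by
              refine mul_le_mul (mul_le_mul (hχ'le' τ) (hη01 τ).2 (hη01 τ).1 hDχ0) (hθ01 y).2
                (hθ01 y).1 (by positivity)
          _ = Dχ := by ring
      nlinarith
    have hφL : ∀ τ y, (Δ (φ τ)) y = χ τ * η τ * (Δ θ) y := by
      intro τ y
      have e : φ τ = (χ τ * η τ) • θ := by funext y'; simp [hφ, smul_eq_mul]
      rw [e, InnerProductSpace.laplacian_smul _ ((hθs.of_le (by norm_cast)).contDiffAt), smul_eq_mul]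
    have hφL_le : ∀ τ y, |(Δ (φ τ)) y| ≤ KΔ := by
      intro τ y
      rw [hφL, abs_mul]
      calc |χ τ * η τ| * |(Δ θ) y| ≤ 1 * KΔ := by
            refine mul_le_mul ?_ (hθL y) (abs_nonneg _) zero_le_one
            rw [abs_mul, abs_of_nonneg (hχ01 τ).1, abs_of_nonneg (hη01 τ).1]
            exact mul_le_one₀ (hχ01 τ).2 (hη01 τ).1 (hη01 τ).2
        _ = KΔ := one_mul _
    have hφG_le : ∀ τ y, ‖gradient (φ τ) y‖ ≤ Kθ := by
      intro τ y
      have e : φ τ = (χ τ * η τ) • θ := by funext y'; simp [hφ, smul_eq_mul]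
      have hd : DifferentiableAt ℝ θ y := (hθs.differentiable (by simp)) y
      rw [gradient, LinearIsometryEquiv.norm_map, e, fderiv_const_smul hd, norm_smul]
      calc ‖χ τ * η τ‖ * ‖fderiv ℝ θ y‖ ≤ 1 * Kθ := by
            refine mul_le_mul ?_ (hθD y) (norm_nonneg _) zero_le_one
            rw [Real.norm_eq_abs, abs_mul, abs_of_nonneg (hχ01 τ).1, abs_of_nonneg (hη01 τ).1]
            exact mul_le_one₀ (hχ01 τ).2 (hη01 τ).1 (hη01 τ).2
        _ = Kθ := one_mul _
    -- the derived fields vanish off `Q`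
    have hφt0 : ∀ w : ℝ × EuclideanSpace ℝ (Fin 3), w ∉ Q → timeDeriv φ w.1 w.2 = 0 := fun w hw =>
      (IsSpaceTimeTestOn.timeDeriv_isSpaceTimeTestOn hφtest).apply_eq_zero hw
    have hφL0 : ∀ w : ℝ × EuclideanSpace ℝ (Fin 3), w ∉ Q → (Δ (φ w.1)) w.2 = 0 := fun w hw =>
      (IsSpaceTimeTestOn.laplacian_isSpaceTimeTestOn hφtest).apply_eq_zero hw
    obtain ⟨-, -, hφG0'⟩ := IsSpaceTimeTestOn.continuous_gradient_field hφtest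
    have hφG0 : ∀ w : ℝ × EuclideanSpace ℝ (Fin 3), w ∉ Q → gradient (φ w.1) w.2 = 0 := fun w hw =>
      hφG0' w fun h => hw (hφtest.tsupport_subset h)
    -- the right-hand side is at most `B`
    set I : ℝ × EuclideanSpace ℝ (Fin 3) → ℝ := fun w =>
      ‖u w.1 w.2‖ ^ 2 * (timeDeriv φ w.1 w.2 + 1 * Δ (φ w.1) w.2) +
        (‖u w.1 w.2‖ ^ 2 + 2 * p w.1 w.2) * ⟪u w.1 w.2, gradient (φ w.1) w.2⟫ +
        2 * ⟪(0 : ℝ → EuclideanSpace ℝ (Fin 3) → EuclideanSpace ℝ (Fin 3)) w.1 w.2, u w.1 w.2⟫ * φ w.1 w.2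
      with hI
    set g₀ : ℝ × EuclideanSpace ℝ (Fin 3) → ℝ := fun w =>
      |M| ^ 2 * (Dχ + KΔ) + (|M| ^ 2 + 2 * |p w.1 w.2|) * (|M| * Kθ) with hg₀
    have hg₀i : IntegrableOn g₀ Q volume :=
      (integrable_const _).add (((integrable_const _).add (hpabs.const_mul 2)).mul_const _)
    have hg₀0 : ∀ w, 0 ≤ g₀ w := fun w => by positivity
    have hgi : Integrable (Q.indicator g₀) (volume : Measure (ℝ × EuclideanSpace ℝ (Fin 3))) :=
      hg₀i.integrable_indicator hQmeas
    have hg0 : ∀ w, 0 ≤ Q.indicator g₀ w := fun w => by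
      by_cases hw : w ∈ Q
      · rw [indicator_of_mem hw]; exact hg₀0 w
      · rw [indicator_of_notMem hw]
    have hIle : ∀ᵐ w ∂(volume : Measure (ℝ × EuclideanSpace ℝ (Fin 3))), I w ≤ Q.indicator g₀ w := by
      filter_upwards [hbd'] with w hw
      by_cases hwQ : w ∈ Q
      · rw [indicator_of_mem hwQ]
        have huM := hw hwQ
        have hu2 : ‖u w.1 w.2‖ ^ 2 ≤ |M| ^ 2 := pow_le_pow_left₀ (norm_nonneg _) huM 2
        have t1 : ‖u w.1 w.2‖ ^ 2 * (timeDeriv φ w.1 w.2 + 1 * Δ (φ w.1) w.2) ≤ |M| ^ 2 * (Dχ + KΔ) := by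
          have ha : timeDeriv φ w.1 w.2 + 1 * Δ (φ w.1) w.2 ≤ Dχ + KΔ := by
            rw [one_mul]
            exact add_le_add (hφt_le _ _) ((le_abs_self _).trans (hφL_le _ _))
          rcases le_or_gt 0 (timeDeriv φ w.1 w.2 + 1 * Δ (φ w.1) w.2) with hpos | hneg
          · exact mul_le_mul hu2 ha hpos (by positivity)
          · calc ‖u w.1 w.2‖ ^ 2 * (timeDeriv φ w.1 w.2 + 1 * Δ (φ w.1) w.2) ≤ 0 :=
                  mul_nonpos_of_nonneg_of_nonpos (by positivity) hneg.le
              _ ≤ |M| ^ 2 * (Dχ + KΔ) := by positivity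
        have t2 : (‖u w.1 w.2‖ ^ 2 + 2 * p w.1 w.2) * ⟪u w.1 w.2, gradient (φ w.1) w.2⟫ ≤
            (|M| ^ 2 + 2 * |p w.1 w.2|) * (|M| * Kθ) := by
          have hin : |⟪u w.1 w.2, gradient (φ w.1) w.2⟫| ≤ |M| * Kθ :=
            (abs_real_inner_le_norm _ _).trans (mul_le_mul huM (hφG_le _ _) (norm_nonneg _) hM)
          have hco : |‖u w.1 w.2‖ ^ 2 + 2 * p w.1 w.2| ≤ |M| ^ 2 + 2 * |p w.1 w.2| := by
            calc |‖u w.1 w.2‖ ^ 2 + 2 * p w.1 w.2| ≤ |‖u w.1 w.2‖ ^ 2| + |2 * p w.1 w.2| := abs_add_le _ _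
              _ ≤ |M| ^ 2 + 2 * |p w.1 w.2| := by
                  rw [abs_of_nonneg (by positivity : (0 : ℝ) ≤ ‖u w.1 w.2‖ ^ 2), abs_mul,
                    abs_of_pos (by norm_num : (0 : ℝ) < 2)]
                  linarith
          calc (‖u w.1 w.2‖ ^ 2 + 2 * p w.1 w.2) * ⟪u w.1 w.2, gradient (φ w.1) w.2⟫
              ≤ |(‖u w.1 w.2‖ ^ 2 + 2 * p w.1 w.2) * ⟪u w.1 w.2, gradient (φ w.1) w.2⟫| := le_abs_self _
            _ = |‖u w.1 w.2‖ ^ 2 + 2 * p w.1 w.2| * |⟪u w.1 w.2, gradient (φ w.1) w.2⟫| := abs_mul _ _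
            _ ≤ (|M| ^ 2 + 2 * |p w.1 w.2|) * (|M| * Kθ) :=
                mul_le_mul hco hin (abs_nonneg _) (by positivity)
        have t3 : 2 * ⟪(0 : ℝ → EuclideanSpace ℝ (Fin 3) → EuclideanSpace ℝ (Fin 3)) w.1 w.2, u w.1 w.2⟫ *
            φ w.1 w.2 = 0 := by simp
        simp only [hI, hg₀]
        linarith
      · have h1 := hφt0 w hwQ
        have h2 := hφL0 w hwQ
        have h3 := hφG0 w hwQ
        rw [indicator_of_notMem hwQ]
        simp only [hI, h1, h2, h3, inner_zero_right, mul_zero, zero_add, add_zero]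
        simp
    have hRHS : ∫ w in {w : ℝ × EuclideanSpace ℝ (Fin 3) | w.1 < s}, I w ≤ B := by
      have hS : MeasurableSet {w : ℝ × EuclideanSpace ℝ (Fin 3) | w.1 < s} :=
        measurableSet_lt measurable_fst measurable_const
      calc ∫ w in {w : ℝ × EuclideanSpace ℝ (Fin 3) | w.1 < s}, I w
          ≤ ∫ w in {w : ℝ × EuclideanSpace ℝ (Fin 3) | w.1 < s}, Q.indicator g₀ w := by
            -- no integrability of `I` is needed: a non-integrable `I` integrates to `0`
            by_cases hIi : IntegrableOn I {w : ℝ × EuclideanSpace ℝ (Fin 3) | w.1 < s} volume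
            · exact integral_mono_ae hIi hgi.integrableOn (ae_restrict_of_ae hIle)
            · rw [integral_undef hIi]
              exact integral_nonneg_of_ae (ae_restrict_of_ae (Eventually.of_forall hg0))
        _ ≤ ∫ w, Q.indicator g₀ w := setIntegral_le_integral hgi (Eventually.of_forall hg0)
        _ = ∫ w in Q, g₀ w := integral_indicator hQmeas
        _ = ∫ w in Q, ((|M| ^ 2 * (Dχ + KΔ) + |M| ^ 2 * (|M| * Kθ)) + (2 * (|M| * Kθ)) * |p w.1 w.2|) := by
            refine setIntegral_congr_fun hQmeas fun w _ => ?_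
            simp only [hg₀]
            ring
        _ = (|M| ^ 2 * (Dχ + KΔ) + |M| ^ 2 * (|M| * Kθ)) * VQ + (2 * (|M| * Kθ)) * ∫ w in Q, |p w.1 w.2| := by
            rw [integral_add (integrable_const _) (hpabs.const_mul _), integral_const_mul,
              setIntegral_const, smul_eq_mul, measureReal_def, hQvolR]
            ring
        _ ≤ (|M| ^ 2 * (Dχ + KΔ) + |M| ^ 2 * (|M| * Kθ)) * VQ + (2 * (|M| * Kθ)) * (VQ + P) := by
            gcongr
        _ = |M| ^ 2 * (Dχ + KΔ) * VQ + |M| ^ 3 * Kθ * VQ + 2 * |M| * Kθ * (VQ + P) := by ring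
        _ ≤ B := hB₁B
    -- the left-hand side dominates the dissipation on the set where `φ = 1`
    have hint : Integrable (fun w : ℝ × EuclideanSpace ℝ (Fin 3) =>
        frobeniusNormSq (G w.1 w.2) * φ w.1 w.2) (volume : Measure (ℝ × EuclideanSpace ℝ (Fin 3))) :=
      integrable_mul_of_locallyIntegrableOn (Q := parabolicCylinderOpens R z)
        (locallyIntegrableOn_frobeniusNormSq hG hGloc) hφtest.contDiff.continuous hKc hKQ
        fun w hw => by_contra fun h' => hw (hsuppK w h')
    set S : Set (ℝ × EuclideanSpace ℝ (Fin 3)) := parabolicCylinder r z ∩ {w | w.1 < min s (z.1 - 2 * ε)}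
      with hSdef
    have hSmeas : MeasurableSet S :=
      (isOpen_Ioo.prod isOpen_ball).measurableSet.inter (measurableSet_lt measurable_fst measurable_const)
    have hSsub : S ⊆ {w : ℝ × EuclideanSpace ℝ (Fin 3) | w.1 < s} := fun w hw =>
      show w.1 < s from lt_of_lt_of_le (show w.1 < min s (z.1 - 2 * ε) from hw.2) (min_le_left _ _)
    have hφS : ∀ w ∈ S, φ w.1 w.2 = 1 := by
      rintro ⟨τ, y⟩ ⟨⟨hτ, hy⟩, hτ'⟩
      have hτ2 : τ < min s (z.1 - 2 * ε) := hτ'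
      simp only [hφ]
      rw [hχ1 τ hτ.1.le, hη1 τ ((lt_min_iff.1 hτ2).2).le, hθ1 y hy]
      ring
    have hLHS : ∫ w in S, frobeniusNormSq (G w.1 w.2) ≤
        ∫ w in {w : ℝ × EuclideanSpace ℝ (Fin 3) | w.1 < s}, frobeniusNormSq (G w.1 w.2) * φ w.1 w.2 := by
      calc ∫ w in S, frobeniusNormSq (G w.1 w.2) = ∫ w in S, frobeniusNormSq (G w.1 w.2) * φ w.1 w.2 :=
            setIntegral_congr_fun hSmeas fun w hw => by rw [hφS w hw, mul_one]
        _ ≤ ∫ w in {w : ℝ × EuclideanSpace ℝ (Fin 3) | w.1 < s}, frobeniusNormSq (G w.1 w.2) * φ w.1 w.2 :=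
            setIntegral_mono_set hint.integrableOn
              (Eventually.of_forall fun w => mul_nonneg (frobeniusNormSq_nonneg _) (hφ0 _ _))
              (Eventually.of_forall hSsub)
    have hfirst : 0 ≤ ∫ x, ‖u s x‖ ^ 2 * φ s x :=
      integral_nonneg fun x => mul_nonneg (by positivity) (hφ0 _ _)
    have hdis : ∫ w in S, frobeniusNormSq (G w.1 w.2) ≤ B / 2 := by
      have h2 := hs
      nlinarith [hLHS, hRHS, hfirst, h2]
    -- to `ℝ≥0∞`
    have hSint : IntegrableOn (fun w : ℝ × EuclideanSpace ℝ (Fin 3) => frobeniusNormSq (G w.1 w.2)) S volume := by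
      have h1 : IntegrableOn (fun w : ℝ × EuclideanSpace ℝ (Fin 3) =>
          frobeniusNormSq (G w.1 w.2) * φ w.1 w.2) S volume := hint.integrableOn
      exact h1.congr_fun (fun w hw => by simp only [hφS w hw, mul_one]) hSmeas
    calc ∫⁻ w in S, ENNReal.ofReal (frobeniusNormSq (G w.1 w.2))
        = ENNReal.ofReal (∫ w in S, frobeniusNormSq (G w.1 w.2)) :=
          (ofReal_integral_eq_lintegral_ofReal hSint
            (Eventually.of_forall fun w => frobeniusNormSq_nonneg _)).symm
      _ ≤ ENNReal.ofReal (B / 2) := ENNReal.ofReal_le_ofReal hdis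
  -- countably many `ε`, and the exhaustion of `Q_r(z)` from below the top
  set ε : ℕ → ℝ := fun n => 1 / ((n : ℝ) + 1) with hε
  have hεpos : ∀ n, 0 < ε n := fun n => Nat.one_div_pos_of_nat
  have hall : ∀ᵐ s ∂(volume : Measure ℝ), ∀ n,
      ∫⁻ w in parabolicCylinder r z ∩ {w | w.1 < min s (z.1 - 2 * ε n)},
        ENNReal.ofReal (frobeniusNormSq (G w.1 w.2)) ≤ ENNReal.ofReal (B / 2) :=
    ae_all_iff.2 fun n => key (hεpos n)
  refine setLIntegral_le_of_ae_lt_time (t₀ := z.1) (fun w hw => hw.1.2) ?_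
  filter_upwards [hall] with s hs hst
  obtain ⟨n, hn⟩ := exists_nat_one_div_lt (by linarith : 0 < (z.1 - s) / 2)
  have hn' : s ≤ z.1 - 2 * ε n := by
    have : ε n < (z.1 - s) / 2 := hn
    linarith
  have hset : parabolicCylinder r z ∩ {w : ℝ × EuclideanSpace ℝ (Fin 3) | w.1 < s} ⊆
      parabolicCylinder r z ∩ {w | w.1 < min s (z.1 - 2 * ε n)} := fun w hw =>
    ⟨hw.1, lt_min hw.2 (lt_of_lt_of_le hw.2 hn')⟩
  exact (lintegral_mono_set hset).trans (hs n)

end NSEnergyQuant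

end Literature.Analysis.FluidPDE

end
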